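import Literature.Computability.Cryptography.QuantumCircuit
import Literature.Computability.Cryptography.StatisticalDistance
import HarnessLib

/-!
# Sampling from an approximate pure state: total variation vs. fidelity

Topic `Literature/Computability/QuantumComplexity` (pub-qadeq lane, CLAIMS §5: every classical
adjudication of a sampling-advantage experiment that simulates the IDEAL state `ψ` only up to
fidelity `F = |⟨ψ|φ⟩|²` — truncated MPS/TN samplers for RCS, boson-sampling and quench experiments
(rows E-01…E-10, E-18, E-21, E-46, E-48; ranked items S-6, S-12, S-15, S-16) — converts `F` into a
bound on the total variation distance of the SAMPLED bit-string distributions. This file proves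
that conversion once, in the tree's vocabulary (`bornPMF`, `PMF.tvDist`).)

HONEST FRAMING: instance-level adjudication of specific advantage claims; no claim about BQP vs BPP
or the summit. Nothing here says that any particular simulation reaches any particular fidelity;
the file only fixes the arithmetic `fidelity ↦ TVD bound` and records that the converse direction
fails for a fixed measurement basis.

## Contents (all proved, 0 named facts)

* `overlapSq u v = ‖Σᵢ conj (uᵢ) vᵢ‖²` — the pure-state fidelity `|⟨u|v⟩|²` of two amplitude
  vectors on a finite outcome type.
* `tvDist_bornPMF_eq` — for unit vectors, `‖Born(u) − Born(v)‖_TV = ½ Σᵢ |‖uᵢ‖² − ‖vᵢ‖²|`.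
* `sum_abs_sq_sub_sq_le` — the real-variable core: for `a, b ≥ 0` with `Σ a² = Σ b² = 1`,
  `Σ |a² − b²| ≤ 2 √(1 − (Σ a b)²)` (Cauchy–Schwarz on `|a − b| · (a + b)`).
* `tvDist_bornPMF_le_sqrt_one_sub_sq` — `‖Born(u) − Born(v)‖_TV ≤ √(1 − (Σᵢ ‖uᵢ‖‖vᵢ‖)²)`, and
  `tvDist_bornPMF_le_sqrt_one_sub_overlapSq` — `… ≤ √(1 − |⟨u|v⟩|²)`: the computational-basis
  instance of Nielsen–Chuang Thm 9.1 (`D(p_m, q_m) ≤ D(ρ, σ)` for every POVM) combined with the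
  pure-state identity `D(|a⟩, |b⟩) = √(1 − F(|a⟩, |b⟩)²)` [cite: NielsenChuang2010, §9.2.1 Thm 9.1
  (eq. 9.23) and §9.2.3 eq. (9.99)]; originally Fuchs–van de Graaf [cite: FuchsVandegraaf1999,
  Thm 1]. Proved here directly by Cauchy–Schwarz, without trace norms.
* `tvDist_bornPMF_le_sqrt_one_sub_of_le_overlapSq` — the form used in adjudications: a fidelity
  LOWER bound `F ≤ |⟨u|v⟩|²` gives `TVD ≤ √(1 − F)`.
* `one_sub_overlapSq_le_sum_norm_sub_sq` / `sqrt_one_sub_overlapSq_le_l2` — the new bound is never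
  weaker than the tree's `ℓ²` bound `‖Born(u) − Born(v)‖_TV ≤ ‖u − v‖₂`
  (`Literature.Barriers.QuantumAdvantage.tvDist_bornPMF_le_l2Norm`): `√(1 − |⟨u|v⟩|²) ≤ ‖u − v‖₂`.
* `bornPMF_eq_of_norm_eq`, `bornPMF_phase_mul` — Born laws see only the moduli (site-dependent
  phases are invisible), hence `exists_orthogonal_tvDist_bornPMF_eq_zero`: two ORTHOGONAL unit
  vectors (`|+⟩`, `|−⟩`) with identical computational-basis statistics. So for a FIXED basis there
  is no converse: agreement of sampled statistics (TVD, or any score computed from them such as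
  XEB) does not by itself lower-bound the fidelity; the Fuchs–van de Graaf lower bound
  `1 − F ≤ D` is a statement about the OPTIMAL measurement [cite: NielsenChuang2010, §9.2.3
  eq. (9.110)].

## References

* [NielsenChuang2010] M. A. Nielsen, I. L. Chuang, *Quantum Computation and Quantum Information*,
  10th anniversary ed., CUP 2010: §9.2.1 Theorem 9.1 (eq. (9.23)), §9.2.3 eqs. (9.97)–(9.99),
  (9.110). Read via `lit read book:nielsen2010-quantum-computation-quantum-information-10th-anniversary-ed`
  (chunks 481, 490–491).
* [FuchsVandegraaf1999] C. A. Fuchs, J. van de Graaf, *Cryptographic distinguishability measures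
  for quantum-mechanical states*, IEEE Trans. Inf. Theory 45 (1999) 1216–1227, Thm 1.
-/

noncomputable section

open Finset
open scoped ComplexConjugate

namespace Literature.Computability.QuantumComplexity

open Literature.Computability.Cryptography (bornPMF bornPMF_apply_of_sum_eq_one)

variable {ι : Type*} [Fintype ι]

/-! ### The pure-state fidelity of two amplitude vectors -/

/-- The squared overlap (pure-state fidelity) `|⟨u|v⟩|² = ‖Σᵢ conj (uᵢ) · vᵢ‖²` of two amplitude
vectors on a finite outcome type. [cite: NielsenChuang2010, §9.2.2 (fidelity of pure states)] -/
def overlapSq (u v : ι → ℂ) : ℝ :=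
  ‖∑ i, conj (u i) * v i‖ ^ 2

/-- `0 ≤ |⟨u|v⟩|²`. [folklore] -/
theorem overlapSq_nonneg (u v : ι → ℂ) : 0 ≤ overlapSq u v := sq_nonneg _

/-- `|⟨u|v⟩| ≤ Σᵢ ‖uᵢ‖ ‖vᵢ‖` (triangle inequality). [folklore] -/
theorem norm_sum_conj_mul_le (u v : ι → ℂ) :
    ‖∑ i, conj (u i) * v i‖ ≤ ∑ i, ‖u i‖ * ‖v i‖ := by
  refine (norm_sum_le _ _).trans (le_of_eq (sum_congr rfl fun i _ => ?_))
  rw [norm_mul, Complex.norm_conj]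

/-- `Σᵢ ‖uᵢ‖ ‖vᵢ‖ ≤ 1` for unit vectors (AM–GM termwise). [folklore] -/
theorem sum_norm_mul_norm_le_one {u v : ι → ℂ} (hu : ∑ i, ‖u i‖ ^ 2 = 1)
    (hv : ∑ i, ‖v i‖ ^ 2 = 1) : ∑ i, ‖u i‖ * ‖v i‖ ≤ 1 := by
  have h : ∑ i, 2 * ‖u i‖ * ‖v i‖ ≤ ∑ i, (‖u i‖ ^ 2 + ‖v i‖ ^ 2) :=
    sum_le_sum fun i _ => two_mul_le_add_sq (‖u i‖) (‖v i‖)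
  rw [sum_add_distrib, hu, hv] at h
  have h2 : ∑ i, 2 * ‖u i‖ * ‖v i‖ = 2 * ∑ i, ‖u i‖ * ‖v i‖ := by
    rw [mul_sum]; exact sum_congr rfl fun i _ => by ring
  linarith

/-- `|⟨u|v⟩|² ≤ 1` for unit vectors. [cite: NielsenChuang2010, §9.2.2] -/
theorem overlapSq_le_one {u v : ι → ℂ} (hu : ∑ i, ‖u i‖ ^ 2 = 1) (hv : ∑ i, ‖v i‖ ^ 2 = 1) :
    overlapSq u v ≤ 1 := by
  have h1 := (norm_sum_conj_mul_le u v).trans (sum_norm_mul_norm_le_one hu hv)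
  have h0 : 0 ≤ ‖∑ i, conj (u i) * v i‖ := norm_nonneg _
  unfold overlapSq
  nlinarith

/-! ### The real-variable core (Cauchy–Schwarz) -/

/-- For `a, b ≥ 0` with `Σ a² = Σ b² = 1`: `Σᵢ |aᵢ² − bᵢ²| ≤ 2 √(1 − (Σᵢ aᵢ bᵢ)²)`.
Proof: `|a² − b²| = |a − b| (a + b)`, Cauchy–Schwarz, `Σ (a ∓ b)² = 2 ∓ 2 Σ a b`.
[cite: NielsenChuang2010, §9.2.3 eqs. (9.97)–(9.99) (pure-state case, there via the trace norm)] -/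
theorem sum_abs_sq_sub_sq_le {a b : ι → ℝ} (ha : ∀ i, 0 ≤ a i) (hb : ∀ i, 0 ≤ b i)
    (ha1 : ∑ i, a i ^ 2 = 1) (hb1 : ∑ i, b i ^ 2 = 1) :
    ∑ i, |a i ^ 2 - b i ^ 2| ≤ 2 * Real.sqrt (1 - (∑ i, a i * b i) ^ 2) := by
  set S : ℝ := ∑ i, a i * b i with hS
  have hS1 : S ≤ 1 := by
    have h : ∑ i, 2 * a i * b i ≤ ∑ i, (a i ^ 2 + b i ^ 2) :=
      sum_le_sum fun i _ => two_mul_le_add_sq (a i) (b i)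
    rw [sum_add_distrib, ha1, hb1] at h
    have h2 : ∑ i, 2 * a i * b i = 2 * S := by
      rw [hS, mul_sum]; exact sum_congr rfl fun i _ => by ring
    linarith
  have hS0 : -1 ≤ S := by
    have h : 0 ≤ S := sum_nonneg fun i _ => mul_nonneg (ha i) (hb i)
    linarith
  have hterm : ∀ i, |a i ^ 2 - b i ^ 2| = |a i - b i| * (a i + b i) := by
    intro i
    rw [sq_sub_sq, abs_mul, abs_of_nonneg (add_nonneg (ha i) (hb i)), mul_comm]
  have hCS : ∑ i, |a i - b i| * (a i + b i) ≤
      Real.sqrt (∑ i, |a i - b i| ^ 2) * Real.sqrt (∑ i, (a i + b i) ^ 2) :=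
    Real.sum_mul_le_sqrt_mul_sqrt _ _ _
  have hd : ∑ i, |a i - b i| ^ 2 = 2 - 2 * S := by
    have h : ∀ i, |a i - b i| ^ 2 = a i ^ 2 + b i ^ 2 - 2 * (a i * b i) := fun i => by
      rw [sq_abs]; ring
    simp only [h, sum_sub_distrib, sum_add_distrib, ← mul_sum, ha1, hb1]
    ring
  have hs : ∑ i, (a i + b i) ^ 2 = 2 + 2 * S := by
    have h : ∀ i, (a i + b i) ^ 2 = a i ^ 2 + b i ^ 2 + 2 * (a i * b i) := fun i => by ring
    simp only [h, sum_add_distrib, ← mul_sum, ha1, hb1]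
    ring
  have hprod : Real.sqrt (2 - 2 * S) * Real.sqrt (2 + 2 * S) = 2 * Real.sqrt (1 - S ^ 2) := by
    rw [← Real.sqrt_mul (by linarith : (0 : ℝ) ≤ 2 - 2 * S)]
    have h : (2 - 2 * S) * (2 + 2 * S) = 2 ^ 2 * (1 - S ^ 2) := by ring
    rw [h, Real.sqrt_mul (by norm_num : (0 : ℝ) ≤ 2 ^ 2), Real.sqrt_sq (by norm_num : (0 : ℝ) ≤ 2)]
  calc ∑ i, |a i ^ 2 - b i ^ 2| = ∑ i, |a i - b i| * (a i + b i) := sum_congr rfl fun i _ => hterm i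
    _ ≤ Real.sqrt (∑ i, |a i - b i| ^ 2) * Real.sqrt (∑ i, (a i + b i) ^ 2) := hCS
    _ = 2 * Real.sqrt (1 - S ^ 2) := by rw [hd, hs, hprod]

/-! ### Comparison with the `ℓ²` bound already in the tree -/

/-- `Σᵢ ‖uᵢ − vᵢ‖² = 2 − 2 Re⟨u|v⟩` for unit vectors. [folklore] -/
theorem sum_norm_sub_sq_eq {u v : ι → ℂ} (hu : ∑ i, ‖u i‖ ^ 2 = 1) (hv : ∑ i, ‖v i‖ ^ 2 = 1) :
    ∑ i, ‖u i - v i‖ ^ 2 = 2 - 2 * (∑ i, conj (u i) * v i).re := by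
  have h : ∀ i, ‖u i - v i‖ ^ 2 = ‖u i‖ ^ 2 + ‖v i‖ ^ 2 - 2 * (conj (u i) * v i).re := by
    intro i
    rw [Complex.sq_norm, Complex.sq_norm, Complex.sq_norm, Complex.normSq_sub]
    have hre : (u i * conj (v i)).re = (conj (u i) * v i).re := by
      rw [← Complex.conj_re (u i * conj (v i)), map_mul, Complex.conj_conj]
    rw [hre]
  simp only [h, sum_sub_distrib, sum_add_distrib, ← mul_sum, hu, hv, Complex.re_sum]
  ring

/-- `1 − |⟨u|v⟩|² ≤ ‖u − v‖₂²` for unit vectors: the fidelity bound of this file is never weaker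
than the `ℓ²` bound `Literature.Barriers.QuantumAdvantage.tvDist_bornPMF_le_l2Norm`. [folklore] -/
theorem one_sub_overlapSq_le_sum_norm_sub_sq {u v : ι → ℂ} (hu : ∑ i, ‖u i‖ ^ 2 = 1)
    (hv : ∑ i, ‖v i‖ ^ 2 = 1) : 1 - overlapSq u v ≤ ∑ i, ‖u i - v i‖ ^ 2 := by
  rw [sum_norm_sub_sq_eq hu hv, overlapSq]
  set z : ℂ := ∑ i, conj (u i) * v i with hz
  have hre : z.re ≤ ‖z‖ := Complex.re_le_norm z
  nlinarith [norm_nonneg z, sq_nonneg (1 - ‖z‖)]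

/-- `√(1 − |⟨u|v⟩|²) ≤ ‖u − v‖₂` for unit vectors. [folklore] -/
theorem sqrt_one_sub_overlapSq_le_l2 {u v : ι → ℂ} (hu : ∑ i, ‖u i‖ ^ 2 = 1)
    (hv : ∑ i, ‖v i‖ ^ 2 = 1) :
    Real.sqrt (1 - overlapSq u v) ≤ Real.sqrt (∑ i, ‖u i - v i‖ ^ 2) :=
  Real.sqrt_le_sqrt (one_sub_overlapSq_le_sum_norm_sub_sq hu hv)

/-! ### Born laws of unit vectors -/

variable [Nonempty ι]

/-- For unit vectors the total variation distance of the Born laws is the half-`ℓ¹` distance of the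
squared moduli: `‖Born(u) − Born(v)‖_TV = ½ Σᵢ |‖uᵢ‖² − ‖vᵢ‖²|`.
[cite: NielsenChuang2010, §9.2.1 eq. (9.1) (classical trace distance) with §2.2.5 (Born rule)] -/
theorem tvDist_bornPMF_eq {u v : ι → ℂ} (hu : ∑ i, ‖u i‖ ^ 2 = 1) (hv : ∑ i, ‖v i‖ ^ 2 = 1) :
    (bornPMF u).tvDist (bornPMF v) = 2⁻¹ * ∑ i, |‖u i‖ ^ 2 - ‖v i‖ ^ 2| := by
  rw [PMF.tvDist, tsum_fintype]
  simp only [bornPMF_apply_of_sum_eq_one hu, bornPMF_apply_of_sum_eq_one hv,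
    ENNReal.toReal_ofReal (sq_nonneg _)]

/-- **Sampling bound, modulus form.** For unit vectors,
`‖Born(u) − Born(v)‖_TV ≤ √(1 − (Σᵢ ‖uᵢ‖ ‖vᵢ‖)²)`. [cite: NielsenChuang2010, §9.2.3 eq. (9.99) with
§9.2.1 Thm 9.1] -/
theorem tvDist_bornPMF_le_sqrt_one_sub_sq {u v : ι → ℂ} (hu : ∑ i, ‖u i‖ ^ 2 = 1)
    (hv : ∑ i, ‖v i‖ ^ 2 = 1) :
    (bornPMF u).tvDist (bornPMF v) ≤ Real.sqrt (1 - (∑ i, ‖u i‖ * ‖v i‖) ^ 2) := by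
  rw [tvDist_bornPMF_eq hu hv]
  have h := sum_abs_sq_sub_sq_le (fun i => norm_nonneg (u i)) (fun i => norm_nonneg (v i)) hu hv
  linarith

/-- **Sampling bound, fidelity form (Fuchs–van de Graaf / Nielsen–Chuang, computational basis).**
For unit vectors `u, v` on a finite outcome type, the computational-basis output distributions
satisfy `‖Born(u) − Born(v)‖_TV ≤ √(1 − |⟨u|v⟩|²)`.
[cite: NielsenChuang2010, §9.2.1 Thm 9.1 (eq. 9.23) and §9.2.3 eq. (9.99)]
[cite: FuchsVandegraaf1999, Thm 1] -/
theorem tvDist_bornPMF_le_sqrt_one_sub_overlapSq {u v : ι → ℂ} (hu : ∑ i, ‖u i‖ ^ 2 = 1)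
    (hv : ∑ i, ‖v i‖ ^ 2 = 1) :
    (bornPMF u).tvDist (bornPMF v) ≤ Real.sqrt (1 - overlapSq u v) := by
  refine (tvDist_bornPMF_le_sqrt_one_sub_sq hu hv).trans (Real.sqrt_le_sqrt ?_)
  have h0 : 0 ≤ ‖∑ i, conj (u i) * v i‖ := norm_nonneg _
  have h1 : ‖∑ i, conj (u i) * v i‖ ^ 2 ≤ (∑ i, ‖u i‖ * ‖v i‖) ^ 2 :=
    pow_le_pow_left₀ h0 (norm_sum_conj_mul_le u v) 2
  unfold overlapSq
  linarith

/-- **The form used in adjudications.** If a classical sampler outputs from the Born law of a unit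
vector `v` whose fidelity to the ideal unit vector `u` is AT LEAST `F`, then its samples are within
total variation distance `√(1 − F)` of the ideal distribution.
[cite: NielsenChuang2010, §9.2.3 eqs. (9.99)–(9.101)] -/
theorem tvDist_bornPMF_le_sqrt_one_sub_of_le_overlapSq {u v : ι → ℂ} (hu : ∑ i, ‖u i‖ ^ 2 = 1)
    (hv : ∑ i, ‖v i‖ ^ 2 = 1) {F : ℝ} (hF : F ≤ overlapSq u v) :
    (bornPMF u).tvDist (bornPMF v) ≤ Real.sqrt (1 - F) :=
  (tvDist_bornPMF_le_sqrt_one_sub_overlapSq hu hv).trans (Real.sqrt_le_sqrt (by linarith))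

/-! ### No converse for a fixed basis -/

/-- Born laws depend only on the moduli of the amplitudes. [cite: NielsenChuang2010, §2.2.5] -/
theorem bornPMF_eq_of_norm_eq {u v : ι → ℂ} (hu : ∑ i, ‖u i‖ ^ 2 = 1) (hv : ∑ i, ‖v i‖ ^ 2 = 1)
    (h : ∀ i, ‖u i‖ = ‖v i‖) : bornPMF u = bornPMF v := by
  refine PMF.ext fun i => ?_
  rw [bornPMF_apply_of_sum_eq_one hu, bornPMF_apply_of_sum_eq_one hv, h]

/-- Site-dependent phases are invisible in the computational basis:
`Born(e^{iθ·} u) = Born(u)`. [cite: NielsenChuang2010, §2.2.5] -/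
theorem bornPMF_phase_mul {u : ι → ℂ} (hu : ∑ i, ‖u i‖ ^ 2 = 1) (θ : ι → ℝ) :
    bornPMF (fun i => Complex.exp (θ i * Complex.I) * u i) = bornPMF u := by
  have hn : ∀ i, ‖Complex.exp (θ i * Complex.I) * u i‖ = ‖u i‖ := fun i => by
    rw [norm_mul, Complex.norm_exp_ofReal_mul_I, one_mul]
  have hu' : ∑ i, ‖Complex.exp (θ i * Complex.I) * u i‖ ^ 2 = 1 := by
    simp only [hn]; exact hu
  exact bornPMF_eq_of_norm_eq hu' hu hn

/-- **No converse for a fixed measurement basis.** There are ORTHOGONAL unit vectors (`|+⟩` and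
`|−⟩` on two outcomes) whose computational-basis output distributions coincide: fidelity `0`,
total variation distance `0`. Hence agreement of sampled statistics does not by itself lower-bound
the fidelity; the lower bound `1 − F(ρ,σ) ≤ D(ρ,σ)` of [cite: NielsenChuang2010, §9.2.3 eq. (9.110)]
concerns the trace distance, i.e. the optimal measurement, not a fixed one. -/
theorem exists_orthogonal_tvDist_bornPMF_eq_zero :
    ∃ u v : Fin 2 → ℂ, (∑ i, ‖u i‖ ^ 2 = 1) ∧ (∑ i, ‖v i‖ ^ 2 = 1) ∧ overlapSq u v = 0 ∧
      (bornPMF u).tvDist (bornPMF v) = 0 := by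
  set c : ℝ := (Real.sqrt 2)⁻¹ with hc
  have hc2 : c ^ 2 = 2⁻¹ := by
    rw [hc, inv_pow, Real.sq_sqrt (by norm_num : (0 : ℝ) ≤ 2)]
  have hnc : ‖(c : ℂ)‖ ^ 2 = 2⁻¹ := by rw [Complex.norm_real, Real.norm_eq_abs, sq_abs, hc2]
  refine ⟨![(c : ℂ), (c : ℂ)], ![(c : ℂ), -(c : ℂ)], ?_, ?_, ?_, ?_⟩
  · simp only [Fin.sum_univ_two, Matrix.cons_val_zero, Matrix.cons_val_one, hnc]
    norm_num
  · simp only [Fin.sum_univ_two, Matrix.cons_val_zero, Matrix.cons_val_one,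
      norm_neg, hnc]
    norm_num
  · simp only [overlapSq, Fin.sum_univ_two, Matrix.cons_val_zero, Matrix.cons_val_one,
      mul_neg, add_neg_cancel, norm_zero]
    norm_num
  · have hu : ∑ i, ‖(![(c : ℂ), (c : ℂ)] : Fin 2 → ℂ) i‖ ^ 2 = 1 := by
      simp only [Fin.sum_univ_two, Matrix.cons_val_zero, Matrix.cons_val_one, hnc]
      norm_num
    have hv : ∑ i, ‖(![(c : ℂ), -(c : ℂ)] : Fin 2 → ℂ) i‖ ^ 2 = 1 := by
      simp only [Fin.sum_univ_two, Matrix.cons_val_zero, Matrix.cons_val_one,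
        norm_neg, hnc]
      norm_num
    rw [bornPMF_eq_of_norm_eq hu hv (fun i => by fin_cases i <;> simp), PMF.tvDist_self]

end Literature.Computability.QuantumComplexity

end
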